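import Literature.Topology.FourManifolds.ProjectiveTowers
import Literature.Topology.FourManifolds.ZeroSurgeryHomotopyBallSliceProofs
import HarnessLib

/-!
# Line `embed-dont-dissolve` for crux `ZseSVanishesOnPairs` (stmt-SmoothPoincare4-0368): the BET, as a named statement

Definitions file of the proof line `embed-dont-dissolve` for the crux `ZeroSurgeryExotic.ZseSVanishesOnPairs`
(= `Literature.Uncategorized.SVanishesOnPairs`, item stmt-SmoothPoincare4-0368, route
route-SmoothPoincare4-ZeroSurgeryExotic; checked skeleton `Cruxes/ZseSVanishesOnPairs/Lines/embed_dont_dissolve.lean`,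
registered stubs `stub_puncturedPairSphereEmbeds` (the bet) and `stub_mmswOneSided` (the engine = the Literature named
fact `Knot.rasmussen_nonpos_of_isTowerSlice`), the four transport stubs being accepted Theorems files).  It carries ONLY
the one object the line posits and nothing in the tree yet names without `sorry`:

* `PuncturedPairSpheresEmbedIn o` — THE BET FOR THE ORIENTATION `o` OF `ℂℙ²`: for every Manolescu–Piccirillo
  PAIR-SPHERE DATUM — knots `K, K'`, a smooth slice disc `g` of `K` (`Knot.IsSliceDisc`), a closed smooth 4-manifold
  `X ≃ₕ S⁴` with slice data `(e, f)` for `K'` (`Knot.IsSliceDiscIn X e f`: a smooth ball `e` and a proper disc `f|𝔻²`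
  off `e(B̊⁴)` bounded by `e ∘ K'`), a smooth embedding `j` of the open slice-disc exterior `sliceDiscExterior g =
  B̊⁴ ∖ g(𝔻²)` ONTO `X ∖ (e(𝔻⁴) ∪ f(𝔻²))` (this is what makes `X` the sphere `X(K') ∪_Y (B⁴ ∖ νD)` of a `0`-surgery pair
  up to diffeomorphism — such data exist for every `0`-surgery pair with `K` slice, accepted stub `stub_pairSphereData`),
  a smooth orientation `oX` of `X` for which `e` is orientation preserving, and a point `q` OFF the data
  (`q ∉ e(ℝ⁴) ∪ f(ℝ²)`) — the punctured oriented manifold `(X ∖ {q}, oX)` embeds smoothly and orientation-preservingly in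
  SOME `o`-tower `#ᵗ(ℂℙ², o)` (`IsProjectiveTower o t P oP`, height `t ≥ 0` free; height `0` = `P ≅ S⁴`).
* THE BET of the line is `∃ o, PuncturedPairSpheresEmbedIn o` (registered stub `stub_puncturedPairSphereEmbeds` verbatim
  up to unfolding the skeleton's local abbreviations `IsTower := IsProjectiveTower`, `PuncturedEmbedsInTower`; no closed
  `def : Prop` is declared for it, so that nothing here can be mistaken for a vendored fact).  An OPEN statement: `SmoothPoincare4 ⇒` it for every `o` (height `0`), it `⇒` the crux given MMSW
  Cor. 1.9 (`Theorems/ZeroSurgeryExoticZseSVanishesOnPairsEmbedReduction.lean`), its height-`0` truncation is the route's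
  kill switch `Assembly2` (`Theorems/ZseSVanishesOnPairs/Negative/HeightZero.lean`), and a refutation for either `o` is a
  closed smooth homotopy 4-sphere whose punctures embed in no definite tower of that chirality — in particular not
  diffeomorphic to `S⁴`.  Nearest print: Manolescu–Piccirillo 2023 Lemma 3.5 / Thm. 3.9 and Nakamura 2023 Lemma 3.5 prove
  such embeddings (indeed trace embeddings) for special families of pairs; MMSW 2023 Question 9.12 asks the stronger
  one-sided DISSOLUTION `X # (#ʳℂℙ²) ≅ #ʳℂℙ²`.

No theorem of substance is proved here (one unfolding lemma, the registration anchor); the reduction against this name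
and the calibration `SPC4 ⇒ ∀ o, PuncturedPairSpheresEmbedIn o` live in proof files importing this one.
-/

noncomputable section

-- the prescribed namespace `Summit.<P>.<Sub>.…` duplicates `SmoothPoincare4` (P = Sub)
set_option linter.dupNamespace false

open scoped Manifold ContDiff Topology
open Set Function ContinuousMap
open Literature.Topology.FourManifolds

namespace Summit.SmoothPoincare4.SmoothPoincare4.Theorems.ZseSVanishesOnPairs

/-- **The bet of line `embed-dont-dissolve` for ONE orientation `o` of `ℂℙ²`**: every Manolescu–Piccirillo pair-sphere
datum `(K, K', g, X, e, f, j, oX, q)` with `q` off the slice data has its puncture `(X ∖ {q}, oX)` smoothly and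
orientation-preservingly embedded in some `o`-tower `#ᵗ(ℂℙ², o)` (`IsProjectiveTower`).  For the orientation whose towers
are the printed `#ᵗℂℙ²bar` this makes every `K'` that is `0`-surgery-related to a slice knot H-slice in some `#ᵗℂℙ²bar`
(Manolescu–Piccirillo 2023, Def. 2.4: "projectively H-slice"; Lemma 3.5 and Thm. 3.9 supply it for special pairs), whence
`s(K') ≤ 0` by MMSW 2023 Cor. 1.9.  A DEFINITION (the open statement schema of the line, parametrised by `o`), deliberately
not a Literature fact and carrying no citation tag: nothing in print proves it. -/
def PuncturedPairSpheresEmbedIn (o : SmoothOrientation (𝓡 4) ComplexProjectivePlane) : Prop :=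
  ∀ (K K' : Knot) (g : EuclideanSpace ℝ (Fin 2) → EuclideanSpace ℝ (Fin 4)) (X : Type) [TopologicalSpace X]
    [T2Space X] [SecondCountableTopology X] [ChartedSpace (EuclideanSpace ℝ (Fin 4)) X] [IsManifold (𝓡 4) ∞ X]
    [CompactSpace X] (e : EuclideanSpace ℝ (Fin 4) → X) (f : EuclideanSpace ℝ (Fin 2) → X)
    (j : sliceDiscExterior g → X) (oX : SmoothOrientation (𝓡 4) X) (q : X),
    Nonempty (X ≃ₕ (Metric.sphere (0 : EuclideanSpace ℝ (Fin 5)) 1)) → K.IsSliceDisc g → K'.IsSliceDiscIn X e f →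
    Manifold.IsSmoothEmbedding (𝓡 4) (𝓡 4) ∞ j →
    range j = (e '' Metric.closedBall (0 : EuclideanSpace ℝ (Fin 4)) 1 ∪
      f '' Metric.closedBall (0 : EuclideanSpace ℝ (Fin 2)) 1)ᶜ →
    IsOrientationPreserving (SmoothOrientation.euclidean 4) oX e → q ∉ range e → q ∉ range f →
    ∃ (t : ℕ) (P : Type) (_ : TopologicalSpace P) (_ : T2Space P) (_ : SecondCountableTopology P)
      (_ : ChartedSpace (EuclideanSpace ℝ (Fin 4)) P) (_ : IsManifold (𝓡 4) ∞ P) (_ : CompactSpace P)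
      (oP : SmoothOrientation (𝓡 4) P)
      (jP : ↥((⟨{q}ᶜ, isOpen_compl_singleton⟩ : TopologicalSpace.Opens X)) → P),
      IsProjectiveTower o t P oP ∧ Manifold.IsSmoothEmbedding (𝓡 4) (𝓡 4) ∞ jP ∧
        IsOrientationPreserving (oX.restrict (⟨{q}ᶜ, isOpen_compl_singleton⟩ : TopologicalSpace.Opens X)) oP jP

/-- **Unfolding lemma / registration anchor.**  `PuncturedPairSpheresEmbedIn o` is, verbatim, the per-orientation body
of the registered stub `stub_puncturedPairSphereEmbeds` of the skeleton (with its local abbreviations `IsTower :=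
IsProjectiveTower` and `PuncturedEmbedsInTower` unfolded) and of the hypothesis `hbet` of the accepted reduction
`sVanishesOnPairs_of_towerEngine_of_puncturedPairSpheresEmbed` sharpened to punctures off the data; registered by
`ledger workitem stub-add` so that this vocabulary file proves a registered name + signature. [folklore] -/
theorem puncturedPairSpheresEmbedIn_iff (o : SmoothOrientation (𝓡 4) ComplexProjectivePlane) :
    PuncturedPairSpheresEmbedIn o ↔
      ∀ (K K' : Knot) (g : EuclideanSpace ℝ (Fin 2) → EuclideanSpace ℝ (Fin 4)) (X : Type) [TopologicalSpace X]
        [T2Space X] [SecondCountableTopology X] [ChartedSpace (EuclideanSpace ℝ (Fin 4)) X] [IsManifold (𝓡 4) ∞ X]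
        [CompactSpace X] (e : EuclideanSpace ℝ (Fin 4) → X) (f : EuclideanSpace ℝ (Fin 2) → X)
        (j : sliceDiscExterior g → X) (oX : SmoothOrientation (𝓡 4) X) (q : X),
        Nonempty (X ≃ₕ (Metric.sphere (0 : EuclideanSpace ℝ (Fin 5)) 1)) → K.IsSliceDisc g → K'.IsSliceDiscIn X e f →
        Manifold.IsSmoothEmbedding (𝓡 4) (𝓡 4) ∞ j →
        range j = (e '' Metric.closedBall (0 : EuclideanSpace ℝ (Fin 4)) 1 ∪
          f '' Metric.closedBall (0 : EuclideanSpace ℝ (Fin 2)) 1)ᶜ →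
        IsOrientationPreserving (SmoothOrientation.euclidean 4) oX e → q ∉ range e → q ∉ range f →
        ∃ (t : ℕ) (P : Type) (_ : TopologicalSpace P) (_ : T2Space P) (_ : SecondCountableTopology P)
          (_ : ChartedSpace (EuclideanSpace ℝ (Fin 4)) P) (_ : IsManifold (𝓡 4) ∞ P) (_ : CompactSpace P)
          (oP : SmoothOrientation (𝓡 4) P)
          (jP : ↥((⟨{q}ᶜ, isOpen_compl_singleton⟩ : TopologicalSpace.Opens X)) → P),
          IsProjectiveTower o t P oP ∧ Manifold.IsSmoothEmbedding (𝓡 4) (𝓡 4) ∞ jP ∧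
            IsOrientationPreserving (oX.restrict (⟨{q}ᶜ, isOpen_compl_singleton⟩ : TopologicalSpace.Opens X)) oP jP :=
  Iff.rfl

end Summit.SmoothPoincare4.SmoothPoincare4.Theorems.ZseSVanishesOnPairs

end
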